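import Summits.ABC.ABC.Statement
import Summits.ABC.ABC.Theses.TwistAmplification
import Summits.ABC.ABC.Theorems.SomeWindowSaving.Negative.WindowFinite
import Literature.NumberTheory.EllipticCurves.SzpiroBGEquivalenceProofs
import Literature.NumberTheory.EllipticCurves.SzpiroLocalDataProofs
import Literature.NumberTheory.DiophantineGeometry.AbcHallForms
import Literature.NumberTheory.DiophantineGeometry.MinimalDiscriminantNormProofs
import Literature.Barriers.ABC.HallExponentSharp
import HarnessLib

/-!
# Route TwistAmplification — crux `SomeWindowSaving` (stmt-ABC-1976): the inert box

Sufficient conditions for the crux, kernel-checked and fact-free (line lead, 2026-08-16; the positive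
half of the standing disprover's calibration `someWindowSaving_iff_cofiniteWeakGenSzpiro`, which lives in
the non-importable crux workfile `Cruxes/SomeWindowSaving/Disproof.lean`, and the `InertBox` glue that
both planned lines `inert-box-collapse` / `polynomial-degree-suffices` prove inside their skeletons).

The crux (`Summit.ABC.ABC.Theses.TwistAmplification.SomeWindowSaving`, route r3) asks for SOME window of
generalized-Szpiro ratios `3 < κ < σ` and SOME saving `δ < (σ − κ)/(2σ − 6)` with
`T⁺_[κ,σ](X) ≤ C · X^δ` for all `X ≥ 1`, where `T⁺` counts reduced global minimal models `W₀/ℤ` with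
`c₄ c₆ ≠ 0`, conductor `N ≤ X` and `N^κ ≤ M⁺ := max(|Δ|, |c₄|³) ≤ N^σ`
(`Negative.windowSet / windowCount`; `Negative.someWindowSaving_iff` is `Iff.rfl`).

* `someWindowSaving_of_cofiniteWeakGenSzpiro` — **the inert box.** If `M⁺ ≤ N^K` for every minimal
  integral model with `c₄ c₆ ≠ 0` and conductor `N ≥ N₀` (COFINITE WEAK GENERALIZED SZPIRO, some `K, N₀`),
  then the window `[K'+1, K'+2]`, `K' := max K 3`, contains only curves of conductor `< max N₀ 2`, so every
  slice sits inside ONE finite slice (`Negative.windowSet_finite`) and `δ := 0 < 1/(2K'−2)` is an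
  admissible saving with `C :=` that slice's cardinality. No Shafarevich finiteness, no counting, no twist
  facts. By the disprover's calibration this hypothesis is also NECESSARY modulo the route's supports
  `QuadraticTwistInvariants` (stmt-ABC-1977) and `TwistAmplificationLemma` (stmt-ABC-1978); it is weak abc
  `c ≤ C · rad(abc)^K` in strength (open since Masser–Oesterlé 1985, Bombieri–Gubler §12.5).
* `someWindowSaving_of_weakGenSzpiro` — the `∃ K C, M⁺ ≤ C · N^K` (all minimal models) form, i.e. the
  hypothesis `WeakGeneralizedSzpiro` of both line skeletons.
* `someWindowSaving_of_weakSzpiro_of_weakHall` — the transfer of line `inert-box-collapse`: WEAK SZPIRO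
  (`∃ K C, |Δ_min| ≤ C · N^K` for all `E/ℚ`, Oesterlé 1988 Conj. 1 with an unspecified exponent) and WEAK
  HALL (`∃ θ > 0, C > 0, HallBound θ C`, Elkies 2000 §4.1) give weak generalized Szpiro by the factorisation
  `N ↦ Δ ↦ c₄` (`c₄³ − c₆² = 1728Δ`), hence the crux.
* `someWindowSaving_of_generalizedSzpiroBG` — the crux follows from the generalized Szpiro conjecture,
  Bombieri–Gubler Conj. 12.5.11 (`Literature.NumberTheory.EllipticCurves.GeneralizedSzpiroConjectureBG`,
  `ε := 1`), which is VERBATIM the existing item stmt-ABC-10576 (`CMRescueSzpiro.Target`, `Iff.rfl`): the one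
  item on the summit whose landing closes this crux as filed.
* `someWindowSaving_of_abc` — hence from the summit statement `ABC` itself (B–G Thm. 12.5.12 (a) ⟹ (c),
  proved in the tree: `abcLe_iff_generalizedSzpiroBG_holds`). So no unconditional refutation of the crux
  exists short of `¬ ABC` — the formal content of the disprover's verdict RESISTS.

Deliberately NOT here: the converse direction (needs the two supports above as hypotheses; see the crux
workfile), and any claim about the open stubs of the lines. Lands `--supports stmt-ABC-1976`.
-/

noncomputable section

open IsDedekindDomain WeierstrassCurve
open Summit.ABC.ABC.Theses.TwistAmplification (SomeWindowSaving)
open Summit.ABC.ABC.Theorems.SomeWindowSaving.Negative (windowSet windowCount windowSet_finite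
  someWindowSaving_iff)
open Literature.NumberTheory.EllipticCurves (GeneralizedSzpiroConjectureBG
  abcLe_iff_generalizedSzpiroBG_holds)
open Literature.Barriers.ABC (HallBound)
open Literature.NumberTheory.DiophantineGeometry (hallBound_int_of_hallBound)

-- `Summit.<Summit>.<Problem>` is the mandated summit-side namespace (CONVENTIONS §2); for the
-- single-conjunct summit `ABC` the two coincide, so the duplicate `ABC.ABC` is deliberate.
set_option linter.dupNamespace false

namespace Summit.ABC.ABC.Theorems

/-- **Window confinement.** Under cofinite weak generalized Szpiro with exponent `K ≤ K'` beyond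
conductor `N₀`, every member of the window slice `windowSet (K'+1) (K'+2) X` has conductor
`< max N₀ 2`, hence lies in the slice at scale `max N₀ 2`: a member of conductor `n ≥ max N₀ 2` would
have `n^{K'+1} ≤ M⁺ ≤ n^K ≤ n^{K'}`, impossible for `n ≥ 2`. [folklore] -/
theorem SomeWindowSaving.windowSet_subset_of_cofinite {K K' N₀ : ℝ} (hKK' : K ≤ K')
    (h : ∀ W₀ : WeierstrassCurve ℤ, (W₀.baseChange ℚ).IsElliptic →
      (∀ v : HeightOneSpectrum ℤ, (W₀.baseChange ℚ).IsMinimalAt v) → W₀.c₄ ≠ 0 → W₀.c₆ ≠ 0 →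
        N₀ ≤ (((W₀.baseChange ℚ).conductorNorm ℤ : ℕ) : ℝ) →
          ((max |W₀.Δ| (|W₀.c₄| ^ 3) : ℤ) : ℝ) ≤ (((W₀.baseChange ℚ).conductorNorm ℤ : ℕ) : ℝ) ^ K)
    (X : ℝ) : windowSet (K' + 1) (K' + 2) X ⊆ windowSet (K' + 1) (K' + 2) (max N₀ 2) := by
  intro W hW
  obtain ⟨hE, hmin, ha₁, ha₃, ha₂, hc₄, hc₆, -, hlo, hhi⟩ := hW
  refine ⟨hE, hmin, ha₁, ha₃, ha₂, hc₄, hc₆, ?_, hlo, hhi⟩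
  set n : ℝ := (((W.baseChange ℚ).conductorNorm ℤ : ℕ) : ℝ) with hn
  by_contra hlt
  rw [not_le] at hlt
  have hN₀ : N₀ ≤ n := le_trans (le_max_left _ _) hlt.le
  have hn2 : (2 : ℝ) ≤ n := le_trans (le_max_right _ _) hlt.le
  have hn1 : (1 : ℝ) < n := by linarith
  have hM := h W hE hmin hc₄ hc₆ hN₀
  have h1 : n ^ (K' + 1) ≤ n ^ K' :=
    calc n ^ (K' + 1) ≤ ((max |W.Δ| (|W.c₄| ^ 3) : ℤ) : ℝ) := hlo
      _ ≤ n ^ K := hM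
      _ ≤ n ^ K' := Real.rpow_le_rpow_of_exponent_le hn1.le hKK'
  have h2 : n ^ K' < n ^ (K' + 1) := Real.rpow_lt_rpow_of_exponent_lt hn1 (by linarith)
  linarith

/-- **The inert box** (positive half of the disprover's calibration; the `InertBox` of both lines).
COFINITE WEAK GENERALIZED SZPIRO — some `K, N₀` with `max(|Δ|, |c₄|³) ≤ N^K` for every integral model
minimal at every place, elliptic over `ℚ`, with `c₄ c₆ ≠ 0` and conductor `N ≥ N₀` — implies the crux
`SomeWindowSaving`, with the witness `κ := K'+1`, `σ := K'+2`, `δ := 0`, `K' := max K 3`,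
`C := #windowSet κ σ (max N₀ 2)` (finite by `windowSet_finite`): `3 < κ < σ`,
`0 < (σ−κ)/(2σ−6) = 1/(2K'−2)`, and every slice is contained in the fixed one
(`SomeWindowSaving.windowSet_subset_of_cofinite`). Unconditional; the hypothesis is weak-abc strength
(open), and by `Cruxes/SomeWindowSaving/Disproof.lean` it is equivalent to the crux modulo the route's
supports stmt-ABC-1977/1978. [folklore] -/
theorem someWindowSaving_of_cofiniteWeakGenSzpiro
    (h : ∃ K N₀ : ℝ, ∀ W₀ : WeierstrassCurve ℤ, (W₀.baseChange ℚ).IsElliptic →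
      (∀ v : HeightOneSpectrum ℤ, (W₀.baseChange ℚ).IsMinimalAt v) → W₀.c₄ ≠ 0 → W₀.c₆ ≠ 0 →
        N₀ ≤ (((W₀.baseChange ℚ).conductorNorm ℤ : ℕ) : ℝ) →
          ((max |W₀.Δ| (|W₀.c₄| ^ 3) : ℤ) : ℝ) ≤ (((W₀.baseChange ℚ).conductorNorm ℤ : ℕ) : ℝ) ^ K) :
    SomeWindowSaving := by
  obtain ⟨K, N₀, h⟩ := h
  set K' : ℝ := max K 3 with hK'
  have hK'3 : (3 : ℝ) ≤ K' := le_max_right _ _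
  have hKK' : K ≤ K' := le_max_left _ _
  rw [someWindowSaving_iff]
  refine ⟨K' + 1, K' + 2, 0, ((windowSet (K' + 1) (K' + 2) (max N₀ 2)).ncard : ℝ), by linarith,
    by linarith, ?_, fun X _ ↦ ?_⟩
  · rw [show (K' + 2 - (K' + 1)) / (2 * (K' + 2) - 6) = 1 / (2 * K' - 2) by ring]
    exact div_pos one_pos (by linarith)
  · rw [Real.rpow_zero, mul_one]
    exact_mod_cast Set.ncard_le_ncard (SomeWindowSaving.windowSet_subset_of_cofinite hKK' h X)
      (windowSet_finite _ _ _)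

/-- **Weak generalized Szpiro ⟹ the crux.** If `max(|Δ|, |c₄|³) ≤ C · N^K` for every integral model
minimal at every place and elliptic over `ℚ` (some `K, C`: Bombieri–Gubler Conj. 12.5.11 with `6 + ε`
replaced by SOME exponent — the hypothesis `WeakGeneralizedSzpiro` of the line skeletons), then
`SomeWindowSaving`. Reduction to the cofinite form: for `N ≥ max C 1` one has `C · N^K ≤ N^{K+1}`.
[folklore] -/
theorem someWindowSaving_of_weakGenSzpiro :
    (∃ K C : ℝ, ∀ W₀ : WeierstrassCurve ℤ, (W₀.baseChange ℚ).IsElliptic →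
      (∀ v : IsDedekindDomain.HeightOneSpectrum ℤ, (W₀.baseChange ℚ).IsMinimalAt v) →
        ((max |W₀.Δ| (|W₀.c₄| ^ 3) : ℤ) : ℝ) ≤ C * (((W₀.baseChange ℚ).conductorNorm ℤ : ℕ) : ℝ) ^ K) →
    Summit.ABC.ABC.Theses.TwistAmplification.SomeWindowSaving := by
  rintro ⟨K, C, h⟩
  refine someWindowSaving_of_cofiniteWeakGenSzpiro ⟨K + 1, max C 1, fun W₀ hE hmin _ _ hN ↦ ?_⟩
  set n : ℝ := (((W₀.baseChange ℚ).conductorNorm ℤ : ℕ) : ℝ) with hn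
  have hC : C ≤ n := le_trans (le_max_left _ _) hN
  have hn1 : (1 : ℝ) ≤ n := le_trans (le_max_right _ _) hN
  have hn0 : (0 : ℝ) < n := by linarith
  calc ((max |W₀.Δ| (|W₀.c₄| ^ 3) : ℤ) : ℝ) ≤ C * n ^ K := h W₀ hE hmin
    _ ≤ n * n ^ K := mul_le_mul_of_nonneg_right hC (Real.rpow_nonneg hn0.le K)
    _ = n ^ (K + 1) := by rw [Real.rpow_add_one hn0.ne' K, mul_comm]

/-- From `c · t ^ θ ≤ s` (`t ≥ 0`, `c, θ > 0`): `t ^ 3 ≤ (s / c) ^ (3 / θ)`. [folklore] -/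
theorem SomeWindowSaving.pow_three_le_of_hall {t s c θ : ℝ} (ht : 0 ≤ t) (hc : 0 < c) (hθ : 0 < θ)
    (h : c * t ^ θ ≤ s) : t ^ (3 : ℕ) ≤ (s / c) ^ (3 / θ) := by
  have h1 : t ^ θ ≤ s / c := by
    rw [le_div_iff₀ hc, mul_comm]
    exact h
  have h2 : (t ^ θ) ^ (3 / θ) ≤ (s / c) ^ (3 / θ) :=
    Real.rpow_le_rpow (Real.rpow_nonneg ht θ) h1 (by positivity)
  have h3 : (t ^ θ) ^ (3 / θ) = t ^ (3 : ℕ) := by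
    rw [← Real.rpow_mul ht, show θ * (3 / θ) = (3 : ℝ) by field_simp,
      show (3 : ℝ) = ((3 : ℕ) : ℝ) by norm_num, Real.rpow_natCast]
  rwa [h3] at h2

/-- The real-arithmetic core of `N ↦ Δ ↦ c₄`: from `D ≤ C₁ N^{K₁}` (Szpiro half) and
`c · c4 ^ θ ≤ 1728 D` (Hall half at `(c₄, c₆)`), `max D (c4³) ≤ (C₁ + (1728 C₁/c)^{3/θ}) · N^{K₁ + 3K₁/θ + 3}`
(`N, C₁ ≥ 1`, `K₁ ≥ 0`, `c, θ > 0`, `c4 ≥ 0`). [folklore] -/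
theorem SomeWindowSaving.max_le_of_szpiro_of_hall {N D c4 C₁ K₁ c θ : ℝ} (hN : 1 ≤ N) (hC₁ : 1 ≤ C₁)
    (hK₁ : 0 ≤ K₁) (hc : 0 < c) (hθ : 0 < θ) (hΔ : D ≤ C₁ * N ^ K₁) (hc4 : 0 ≤ c4)
    (hHall : c * c4 ^ θ ≤ 1728 * D) :
    max D (c4 ^ 3) ≤ (C₁ + (1728 * C₁ / c) ^ (3 / θ)) * N ^ (K₁ + K₁ * (3 / θ) + 3) := by
  have hN0 : 0 < N := by linarith
  have hK3 : 0 ≤ K₁ * (3 / θ) := mul_nonneg hK₁ (div_nonneg (by norm_num) hθ.le)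
  have hB0 : 0 ≤ 1728 * C₁ / c := div_nonneg (mul_nonneg (by norm_num) (by linarith)) hc.le
  have hA0 : 0 ≤ (1728 * C₁ / c) ^ (3 / θ) := Real.rpow_nonneg hB0 _
  have hs : c * c4 ^ θ ≤ 1728 * C₁ * N ^ K₁ := by
    calc c * c4 ^ θ ≤ 1728 * D := hHall
      _ ≤ 1728 * (C₁ * N ^ K₁) := mul_le_mul_of_nonneg_left hΔ (by norm_num)
      _ = 1728 * C₁ * N ^ K₁ := by ring
  have h3 : c4 ^ (3 : ℕ) ≤ (1728 * C₁ * N ^ K₁ / c) ^ (3 / θ) :=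
    SomeWindowSaving.pow_three_le_of_hall hc4 hc hθ hs
  have hsplit : (1728 * C₁ * N ^ K₁ / c) ^ (3 / θ) =
      (1728 * C₁ / c) ^ (3 / θ) * N ^ (K₁ * (3 / θ)) := by
    rw [show 1728 * C₁ * N ^ K₁ / c = (1728 * C₁ / c) * N ^ K₁ by ring,
      Real.mul_rpow hB0 (Real.rpow_nonneg hN0.le _), ← Real.rpow_mul hN0.le]
  refine max_le ?_ ?_
  · calc D ≤ C₁ * N ^ K₁ := hΔ
      _ ≤ (C₁ + (1728 * C₁ / c) ^ (3 / θ)) * N ^ (K₁ + K₁ * (3 / θ) + 3) :=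
          mul_le_mul (by linarith) (Real.rpow_le_rpow_of_exponent_le hN (by linarith))
            (Real.rpow_nonneg hN0.le _) (by linarith)
  · calc c4 ^ 3 ≤ (1728 * C₁ * N ^ K₁ / c) ^ (3 / θ) := h3
      _ = (1728 * C₁ / c) ^ (3 / θ) * N ^ (K₁ * (3 / θ)) := hsplit
      _ ≤ (C₁ + (1728 * C₁ / c) ^ (3 / θ)) * N ^ (K₁ + K₁ * (3 / θ) + 3) :=
          mul_le_mul (by linarith) (Real.rpow_le_rpow_of_exponent_le hN (by linarith))
            (Real.rpow_nonneg hN0.le _) (by linarith)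

/-- **Weak Szpiro ∧ weak Hall ⟹ the crux** (the transfer of line `inert-box-collapse`). WEAK SZPIRO:
`∃ K C, |Δ_min(E)| ≤ C · N_E^K` for every elliptic `E/ℚ` (Oesterlé, Sém. Bourbaki 694 (1988) §2 Conj. 1
with an unspecified exponent; vocabulary of `Literature.NumberTheory.EllipticCurves.SzpiroConjecture`).
WEAK HALL: `∃ θ > 0, C > 0, HallBound θ C`, i.e. `C · x^θ ≤ |x³ − y²|` over the positive naturals (open for
every `θ > 0`, Elkies 2000 §4.1). Factorisation `N ↦ Δ ↦ c₄`: `N(𝔇_min) = |Δ(W₀)|` for a model minimal at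
every place (`minimalDiscriminantNorm_eq_natAbs_holds`), and Hall at `(c₄, c₆)` with `c₄³ − c₆² = 1728Δ`
(`WeierstrassCurve.c_relation`, `hallBound_int_of_hallBound`) bounds `|c₄|³`; then
`someWindowSaving_of_weakGenSzpiro`. Both hypotheses are open; both follow from `ABC` by proved tree theorems.
[folklore] -/
theorem someWindowSaving_of_weakSzpiro_of_weakHall
    (hS : ∃ K C : ℝ, ∀ (W : WeierstrassCurve ℚ) [W.IsElliptic],
      (W.minimalDiscriminantNorm ℤ : ℝ) ≤ C * (W.conductorNorm ℤ : ℝ) ^ K)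
    (hH : ∃ θ C : ℝ, 0 < θ ∧ 0 < C ∧ HallBound θ C) : SomeWindowSaving := by
  obtain ⟨K₁, C₁, hS⟩ := hS
  -- weak Hall over ℤ with an exponent `θ ≤ 3`
  obtain ⟨θ, c, hθ, hc, hHZ⟩ : ∃ θ c : ℝ, 0 < θ ∧ 0 < c ∧
      ∀ x y : ℤ, x ^ 3 ≠ y ^ 2 → c * |(x : ℝ)| ^ θ ≤ |(x : ℝ) ^ 3 - (y : ℝ) ^ 2| := by
    obtain ⟨θ, C, hθ, hC, h⟩ := hH
    refine ⟨min θ 3, min C 1, lt_min hθ (by norm_num), lt_min hC one_pos, ?_⟩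
    have h' : HallBound (min θ 3) C := by
      intro x y hx hy hne
      have hx1 : (1 : ℝ) ≤ (x : ℝ) := by exact_mod_cast hx
      calc C * (x : ℝ) ^ (min θ 3) ≤ C * (x : ℝ) ^ θ :=
            mul_le_mul_of_nonneg_left (Real.rpow_le_rpow_of_exponent_le hx1 (min_le_left _ _)) hC.le
        _ ≤ |(x : ℝ) ^ 3 - (y : ℝ) ^ 2| := h x y hx hy hne
    exact hallBound_int_of_hallBound (min_le_right θ 3) h'
  have hK : (0 : ℝ) ≤ max K₁ 0 := le_max_right _ _
  have hC : (1 : ℝ) ≤ max C₁ 1 := le_max_right _ _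
  refine someWindowSaving_of_weakGenSzpiro ⟨max K₁ 0 + max K₁ 0 * (3 / θ) + 3,
    max C₁ 1 + (1728 * max C₁ 1 / c) ^ (3 / θ), fun W₀ hE hmin ↦ ?_⟩
  have hN1 : (1 : ℝ) ≤ (((W₀.baseChange ℚ).conductorNorm ℤ : ℕ) : ℝ) := by
    exact_mod_cast conductorNorm_pos_holds (W₀.baseChange ℚ)
  have hΔ0 : W₀.Δ ≠ 0 := Δ_ne_zero_of_isElliptic_baseChange_int W₀
  -- Szpiro half, normalised: |Δ| ≤ C₁' N^{K₁'}
  have hΔ : |(W₀.Δ : ℝ)| ≤ max C₁ 1 * (((W₀.baseChange ℚ).conductorNorm ℤ : ℕ) : ℝ) ^ (max K₁ 0) := by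
    have h1 := hS (W₀.baseChange ℚ)
    rw [minimalDiscriminantNorm_eq_natAbs_holds W₀ hΔ0 hmin, Nat.cast_natAbs, Int.cast_abs] at h1
    calc |(W₀.Δ : ℝ)| ≤ C₁ * (((W₀.baseChange ℚ).conductorNorm ℤ : ℕ) : ℝ) ^ K₁ := h1
      _ ≤ max C₁ 1 * (((W₀.baseChange ℚ).conductorNorm ℤ : ℕ) : ℝ) ^ K₁ :=
          mul_le_mul_of_nonneg_right (le_max_left _ _) (Real.rpow_nonneg (by linarith) _)
      _ ≤ max C₁ 1 * (((W₀.baseChange ℚ).conductorNorm ℤ : ℕ) : ℝ) ^ (max K₁ 0) :=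
          mul_le_mul_of_nonneg_left (Real.rpow_le_rpow_of_exponent_le hN1 (le_max_left _ _))
            (by linarith)
  -- Hall half at (c₄, c₆): c |c₄|^θ ≤ |c₄³ − c₆²| = 1728 |Δ|
  have hne : W₀.c₄ ^ 3 ≠ W₀.c₆ ^ 2 := by
    intro h
    apply hΔ0
    have hrel := W₀.c_relation
    rw [h, sub_self] at hrel
    exact (mul_eq_zero.mp hrel).resolve_left (by norm_num)
  have hHall : c * |(W₀.c₄ : ℝ)| ^ θ ≤ 1728 * |(W₀.Δ : ℝ)| := by
    have hrelR : (W₀.c₄ : ℝ) ^ 3 - (W₀.c₆ : ℝ) ^ 2 = 1728 * (W₀.Δ : ℝ) := by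
      exact_mod_cast W₀.c_relation.symm
    calc c * |(W₀.c₄ : ℝ)| ^ θ ≤ |(W₀.c₄ : ℝ) ^ 3 - (W₀.c₆ : ℝ) ^ 2| := hHZ W₀.c₄ W₀.c₆ hne
      _ = 1728 * |(W₀.Δ : ℝ)| := by
          rw [hrelR, abs_mul, abs_of_pos (by norm_num : (0 : ℝ) < 1728)]
  have key := SomeWindowSaving.max_le_of_szpiro_of_hall hN1 hC hK hc hθ hΔ (abs_nonneg (W₀.c₄ : ℝ)) hHall
  push_cast
  exact key

/-- **Generalized Szpiro (B–G Conj. 12.5.11) ⟹ the crux.** The catalogued conjecture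
`Literature.NumberTheory.EllipticCurves.GeneralizedSzpiroConjectureBG`
(`∀ ε > 0 ∃ C, max(|Δ|, |c₄|³) ≤ C · N^{6+ε}` for all minimal integral models) — verbatim the existing
item stmt-ABC-10576 (`Summit.ABC.ABC.Theses.CMRescueSzpiro.Target`) — gives `SomeWindowSaving`, through
`someWindowSaving_of_weakGenSzpiro` at `ε := 1`. CONDITIONAL on that open conjecture (≡ `ABC`,
B–G Thm. 12.5.12): it records which single existing item closes this crux, nothing more. [folklore] -/
theorem someWindowSaving_of_generalizedSzpiroBG (h : GeneralizedSzpiroConjectureBG) :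
    SomeWindowSaving := by
  obtain ⟨C, hC⟩ := h 1 one_pos
  exact someWindowSaving_of_weakGenSzpiro ⟨6 + 1, C, fun W₀ hE hmin ↦ by exact_mod_cast hC W₀ hE hmin⟩

/-- **The summit implies the crux**: `ABC → SomeWindowSaving`, through Bombieri–Gubler Thm. 12.5.12
(a) ⟹ (c) (`abcLe_iff_generalizedSzpiroBG_holds`, proved in the tree; `ABC`'s strict `<` / `0 < C` form
weakened to the printed `≤` form) and `someWindowSaving_of_generalizedSzpiroBG`. Consequence: the crux
(rung r3 of a route TOWARDS `ABC`) is not refutable by any unconditional theorem unless `ABC` is false.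
[folklore] -/
theorem someWindowSaving_of_abc (habc : _root_.ABC) : SomeWindowSaving := by
  refine someWindowSaving_of_generalizedSzpiroBG (abcLe_iff_generalizedSzpiroBG_holds.mp fun ε hε ↦ ?_)
  obtain ⟨C, -, hC⟩ := habc ε hε
  exact ⟨C, fun a b c h ↦ (hC a b c h).le⟩

end Summit.ABC.ABC.Theorems

end
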